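/-
Copyright (c) 2026 the pub-hodgecm-mathlib formalisation cell (harness21).  Prover seat hodgecm-mathlib-LH4-p14 (g0), Track A «FOUR-FRAME» squad (req620 EMIT, dealer LH4-plan (g10)
WORD #25 (B)), TIER 2 for the socket `U1_Frames`: payment of `stub_U1_normPairs_iff_frames` — the norm pairs of `γ_H` are EXACTLY the conjugates of the four frame literals.  2026-09-03.
-/
import Literature.NumberTheory.Rogawski1990.LocalTransferIdentityCoreDyadicDescent                -- (organ vocabulary, as the socket) `IsLocalNormPair`, `IsLocalGRegular`, `cmDatum`, …
import Literature.NumberTheory.Rogawski1990.ShalikaGermExpansionUnitaryThreeNonsplitCM             -- (organ vocabulary, as the socket)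
import Literature.NumberTheory.Rogawski1990.LocalTransferAtOneOfShalikaRankUnramifiedAll           -- (organ vocabulary, as the socket) ★ `localNonsplitEquiv`, `finGammaTwo`; brings ★ `placeForm_antidiagOne`
import Literature.NumberTheory.Automorphic.LocalUnitaryGroupCongr                                  -- (organ vocabulary, as the socket) ★ `galAdicCompletionMap`, `placeForm`
import Literature.NumberTheory.Rogawski1990.UnitFundamentalLemmaInertFlickerFrame                  -- ★ `isLocalNormPair_iff_isConj_endoGL_conj` (matching = conjugacy in the one-place model), ★ `coe_endoGL`
import Literature.NumberTheory.Rogawski1990.LocalStableClassesNonsplitTypeOneCount                 -- ★ `exists_unitary_conj_iff_forall_exists_norm` (classes in a type-(1) stable class, read in the eigenframe); brings ★ `twistGram` kit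
import Literature.NumberTheory.Rogawski1990.AdelicStableClassSupportFinite                         -- ★ `isConj_of_charpoly_eq_of_separable`
import Literature.NumberTheory.Automorphic.UnitaryThreeFourFrameEigenframe                         -- ★ p854605 (B-p04): `exists_eigenframe_smul_frameElt`, `charpoly_smul_frameElt`, `separable_charpoly_smul_frameElt`, `injective_eigenvalues`
import Literature.NumberTheory.Automorphic.UnitaryThreeFourFrameFamilyExists                      -- ★ p854761 (F0P3-p01): `normSign_of_isNorm ∕ _of_not_isNorm`, `normSign_mul_of_dichotomy`; brings ★ (J3) `IsCMField.exists_fixed_nonnorm_dichotomy`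
import Literature.NumberTheory.Automorphic.UnitaryGroupArithmeticLevels                            -- ★ `ShimuraVarieties.unitaryGroup_eq_unitaryGroupOfForm` (the two renderings of `U(σ, H)`)
import Literature.NumberTheory.Automorphic.RankTwoEigenframeOfSplitCharpoly                        -- ★ `exists_eq_X_sub_C_mul_X_sub_C_of_isRoot` (monic quadratic with a root)
import Summits.HodgeConjecture.HodgeConjecture.Theorems.F0P3cDyRamFrameClassesDistinct             -- ★ p854652 (B-p04): `normSign_mul_norm`
import Literature.NumberTheory.Automorphic.UnitaryLatticeTreeBlockGluing                          -- ★ `pairing_comm_of_hermitian` (`⟨x, x⟩` is `σ`-fixed)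
import HarnessLib

/-!
# (D-RAM) «FOUR-FRAME» road, unit (i), TIER 2: THE NORM PAIRS OF `γ_H` ARE EXACTLY THE CONJUGATES OF THE FOUR FRAME LITERALS —
# `IsLocalNormPair L Φ₃ v γ_H t ↔ ∃ b, ⟦t⟧ = ⟦t_b⟧` (payment of `U1_Frames.stub_U1_normPairs_iff_frames`; (D-CΔ) clause (C)₁)

Cell `pub/hodgecm-mathlib` (D-0151), crux H413 = `stmt-HodgeConjecture-24833`, organ (D-RAM) `stub_DyRamCore`, «FOUR-FRAME» road, Track A; tier-1 socket
`Cruxes/H413/Lines/F0_P3c_DyRamFourFrame_U1_Frames.lean` ED. 2, stub **`stub_U1_normPairs_iff_frames (N₀)`** (statement VERBATIM as the head `normPairs_iff_frames`): at a wild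
non-split place, for `γ_H ∈ H(L⁺_v)`, ANY four-frame family `f` (H7), norm-one `a, b, z` PINNED to `γ_H` (`z = γ₂ = finGammaTwo`, `z a², z b²` the roots at `w` of `χ_g`), a
regular element datum for `(a², b²)` (E) and group literals `t_b ∈ U(Φ₃)(L⁺_v)` with one-place matrix `z·Γ_b`, `Γ_b = frameElt σ_w f b (a²) (b²)`: for every `t ∈ U(Φ₃)(L⁺_v)`,
`ι_v(γ_H) ↔ t` (★ `IsLocalNormPair`) **iff** `t` is conjugate to one of the four `t_b`.

THE MATHEMATICS ([Rogawski1990, §3.5 Prop. 3.5.2 (a)(c) p. 29, §3.6 p. 31, §4.9 p. 54]).  Matching is conjugacy in `GL₃(L_w)` of the one-place matrices (★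
`isLocalNormPair_iff_isConj_endoGL_conj`); `ι((γ_H)_w) = ι(g_w, (z))` has characteristic polynomial `χ_{g_w}·(X − z) = (X − za²)(X − zb²)(X − z)` by the pins (§3), the same
as every literal `z·Γ_b` (★ `charpoly_smul_frameElt`), SEPARABLE for a regular datum.  (←): conjugates have equal characteristic polynomials, and equal separable characteristic
polynomials force `GL₃`-conjugacy (★ `isConj_of_charpoly_eq_of_separable`).  (→): `M := t_w ∈ U(σ_w, Φ₃)(L_w)` lies in the `GL₃`-class of the base literal `N₀ = z·Γ₀ =
Q₀·diag(u)·Q₀⁻¹` (eigenframe `Q₀` = frame matrix, ★ `exists_eigenframe_smul_frameElt`): `M = S N₀ S⁻¹`.  By the CRITERION IN THE EIGENFRAME (★ `exists_unitary_conj_iff_forall_exists_norm`,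
[Prop. 3.5.2 (a)] coordinatewise) two stable conjugates of `N₀` are `U(Φ₃)`-conjugate iff their eigenvector lengths differ by norms.  The literal `N_b = (Q_b Q₀⁻¹) N₀ (Q_b Q₀⁻¹)⁻¹`
has lengths `N(f_{b,i})` of classes `(ε₁, ε₂, ω(−1)ε₁ε₂)`, `(ε₁, ε₂) = signPair b` (H7); the lengths `rᵢ` of `M` are `σ_w`-fixed, non-zero, `∏ rᵢ = N(det S)·∏ N(f_{0,i})` (★
`prod_twistGram_mul_eigenframe_eq`), so `ω(r₂) = ω(−1)ω(r₀)ω(r₁)` (local norm index two: ★ (J3) `IsCMField.exists_fixed_nonnorm_dichotomy`, ★ `normSign_mul_of_dichotomy`) and the frame `b`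
with `signPair b = (ω(r₀), ω(r₁))` has all three length ratios norms (§1), whence a unitary `W` with `W N_b W⁻¹ = M`, pulled back to `U(Φ₃)(L⁺_v)` along ★ `localNonsplitEquiv`.

* §1 generic algebra (field `K`, endomorphism `σ`): `charpoly_eq_of_isConj`, `charpoly_endoGL`, `twistGram_apply_eq_pairing`, `exists_signPair_eq`, **`exists_eq_norm_mul_of_normSign_eq`**, ….
* §2 **`exists_unitary_conj_frameElt_of_charpoly_eq`** — the `U(Φ₃)`-classification above (generic `K`, `σ` involutive with the norm dichotomy).
* §3 one-place plumbing at the CM place: `isLocalNormPair_iff_isConj_endoGL_one`, `charpoly_endoGL_eq_of_pins`, `isConj_coe_localNonsplitEquiv_of_mk_eq_mk`, `mk_eq_mk_of_unitary_conj_eq`.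
* §4 **`normPairs_iff_frames`** — `U1_Frames.stub_U1_normPairs_iff_frames` TOKEN FOR TOKEN (the neighbourhood `V` is `univ`: no smallness is used).

HONEST LABEL: HC_CM is proved only modulo the 7 printed citations (2 remaining named inputs: hLiu418 = stmt-HodgeConjecture-24832, h413 = stmt-HodgeConjecture-24833) until rung 0
closes; `--supports stmt-HodgeConjecture-24833` helper; unconditional local linear algebra (no `sorry`, no new `def`).
-/

noncomputable section

open scoped Valued WithZero Matrix MatrixGroups
open Polynomial
namespace Summit.HodgeConjecture.HodgeConjecture.Cruxes.H413.F0P3cDyRamNormPairsIffFrames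

open NumberField IsDedekindDomain Topology Filter Literature.NumberTheory.Rogawski1990 Literature.NumberTheory.GaloisRepresentations
open Literature.NumberTheory.Automorphic Literature.NumberTheory.Automorphic.UnitaryGroup Literature.NumberTheory.Automorphic.UnitaryLatticeTree
open Literature.NumberTheory.Automorphic.UnitaryThreeFourFrame
open Summit.HodgeConjecture.HodgeConjecture.Cruxes.H413.F0P3cDyRamFrameClassesDistinct (normSign_mul_norm)

/-! ## §1  Generic algebra -/

section Generic

variable {K : Type} [Field K]

/-- The characteristic polynomial is a conjugation invariant in `GL_m(K)`. [folklore] -/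
theorem charpoly_eq_of_isConj {m : ℕ} {A B : GL (Fin m) K} (h : IsConj A B) :
    (B : Matrix (Fin m) (Fin m) K).charpoly = (A : Matrix (Fin m) (Fin m) K).charpoly := by
  obtain ⟨c, hc⟩ := isConj_iff.1 h
  rw [← hc, Units.val_mul, Units.val_mul, Matrix.coe_units_inv, Matrix.charpoly_units_conj]

/-- A monic quadratic over a field with two distinct roots is the product of the two linear factors. [folklore] -/
theorem eq_X_sub_C_mul_X_sub_C_of_isRoot_of_isRoot {p : K[X]} (hp : p.Monic) (hdeg : p.natDegree = 2) {r s : K}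
    (hr : p.IsRoot r) (hs : p.IsRoot s) (hrs : r ≠ s) : p = (X - C r) * (X - C s) := by
  obtain ⟨s', hfac⟩ := exists_eq_X_sub_C_mul_X_sub_C_of_isRoot hp hdeg hr
  have h : (s - r) * (s - s') = 0 := by
    have h0 : p.eval s = 0 := hs
    rwa [hfac, eval_mul, eval_sub, eval_sub, eval_X, eval_C, eval_C] at h0
  rcases mul_eq_zero.1 h with h1 | h1
  · exact absurd (sub_eq_zero.1 h1) (Ne.symm hrs)
  · rw [hfac, sub_eq_zero.1 h1]

/-- **`charpoly ι(g₂, g₁) = charpoly g₂ · (X − (g₁)₀₀)`** for the endoscopic pattern `ι(g₂, g₁) = (a 0 b; 0 u 0; c 0 d)` (★ `endoGL`, a reindexed block sum).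
[cite: Rogawski1990, §4.8 Case (a) p. 53] -/
theorem charpoly_endoGL (g₂ : GL (Fin 2) K) (g₁ : GL (Fin 1) K) :
    ((endoGL (g₂, g₁) : GL (Fin 3) K) : Matrix (Fin 3) (Fin 3) K).charpoly =
      (g₂ : Matrix (Fin 2) (Fin 2) K).charpoly * (X - C ((g₁ : Matrix (Fin 1) (Fin 1) K) 0 0)) := by
  rw [coe_endoGL, Matrix.charpoly_reindex, Matrix.charpoly_fromBlocks_zero₁₂]
  congr 1
  have h1 : (g₁ : Matrix (Fin 1) (Fin 1) K) = Matrix.diagonal fun _ => (g₁ : Matrix (Fin 1) (Fin 1) K) 0 0 := by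
    ext i j; fin_cases i; fin_cases j; rfl
  conv_lhs => rw [h1]
  rw [Matrix.charpoly_diagonal, Fin.prod_univ_one]

/-- The entries of `H_X = ᵗ(σX) H X` (★ `twistGram`) are the `H`-pairings of the COLUMNS of `X` (★ `pairing`). [cite: Jacobowitz1962, §4] -/
theorem twistGram_apply_eq_pairing {N : ℕ} (σ : K →+* K) (H X : Matrix (Fin N) (Fin N) K) (i j : Fin N) :
    twistGram σ H X i j = pairing σ H (fun k => X k i) (fun k => X k j) := by
  rw [twistGram_def, pairing_apply, Matrix.mul_apply]
  simp only [Matrix.mul_apply, Matrix.transpose_apply, Matrix.map_apply, Finset.sum_mul]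
  rw [Finset.sum_comm]

/-- The diagonal of `H_{Q_b}` for the FRAME MATRIX `Q_b = (Matrix.of (f b))ᵀ` (columns `f_{b,i}`) lists the norms `N(f_{b,i}) = ⟨f_{b,i}, f_{b,i}⟩`. [cite: Jacobowitz1962, §4] -/
theorem twistGram_frameMatrix_apply_self {N : ℕ} (σ : K →+* K) (H : Matrix (Fin N) (Fin N) K) (g : Fin N → (Fin N → K)) (i : Fin N) :
    twistGram σ H (Matrix.of g)ᵀ i i = pairing σ H (g i) (g i) := by
  rw [twistGram_apply_eq_pairing]
  rfl

/-- `ω(x) ∈ {±1}` (H1). [cite: Rogawski1990, §4.9 p. 55] -/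
theorem normSign_eq_one_or (σ : K →+* K) (x : K) : normSign σ x = 1 ∨ normSign σ x = -1 := by
  unfold normSign
  split_ifs <;> simp

/-- The frame index `signPair : Fin 4 → {±1}²` is onto (H4). [cite: Rogawski1990, §4.9 p. 55] -/
theorem exists_signPair_eq {ε₁ ε₂ : ℤ} (h₁ : ε₁ = 1 ∨ ε₁ = -1) (h₂ : ε₂ = 1 ∨ ε₂ = -1) : ∃ b : Fin 4, signPair b = (ε₁, ε₂) := by
  rcases h₁ with rfl | rfl <;> rcases h₂ with rfl | rfl
  exacts [⟨0, rfl⟩, ⟨1, rfl⟩, ⟨2, rfl⟩, ⟨3, rfl⟩]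

/-- **EQUAL NORM-CLASS SIGNS ⇒ THE RATIO IS A NORM** under the index-two dichotomy of the local norm index theorem (`ε` a `σ`-fixed non-norm such that every
`σ`-fixed `s ≠ 0` is a norm or has `ε·s` a norm): for `σ`-fixed non-zero `x, y` with `ω(x) = ω(y)` there is `c ≠ 0` with `x = σ(c)·c·y`.
[cite: Serre1979, Ch. XIV §3] [cite: Rogawski1990, §3.5 Prop. 3.5.2 (a) p. 29] -/
theorem exists_eq_norm_mul_of_normSign_eq (σ : K →+* K) {ε : K} (hεn : ¬ ∃ t : K, t * σ t = ε)
    (hdich : ∀ s : K, σ s = s → s ≠ 0 → (∃ t : K, t * σ t = s) ∨ ∃ t : K, t * σ t = ε * s)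
    {x y : K} (hx : σ x = x) (hy : σ y = y) (hx0 : x ≠ 0) (hy0 : y ≠ 0) (h : normSign σ x = normSign σ y) :
    ∃ c : K, c ≠ 0 ∧ x = σ c * c * y := by
  have hε0 : ε ≠ 0 := fun h0 => hεn ⟨0, by rw [h0, zero_mul]⟩
  by_cases hyN : ∃ t : K, t * σ t = y
  · obtain ⟨t, ht⟩ := hyN
    have hxN : ∃ s : K, s * σ s = x := by
      by_contra hxN
      rw [normSign_of_isNorm σ ⟨t, ht⟩, normSign_of_not_isNorm σ hxN] at h
      norm_num at h
    obtain ⟨s, hs⟩ := hxN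
    have ht0 : t ≠ 0 := fun h0 => hy0 (by rw [← ht, h0, zero_mul])
    have hσt0 : σ t ≠ 0 := (map_ne_zero σ).2 ht0
    refine ⟨s / t, div_ne_zero (fun h0 => hx0 (by rw [← hs, h0, zero_mul])) ht0, ?_⟩
    rw [← hs, ← ht, map_div₀]
    field_simp
  · have hxN : ¬ ∃ s : K, s * σ s = x := by
      intro hxN
      rw [normSign_of_isNorm σ hxN, normSign_of_not_isNorm σ hyN] at h
      norm_num at h
    obtain ⟨s, hs⟩ := (hdich x hx hx0).resolve_left hxN
    obtain ⟨t, ht⟩ := (hdich y hy hy0).resolve_left hyN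
    have ht0 : t ≠ 0 := fun h0 => (mul_ne_zero hε0 hy0) (by rw [← ht, h0, zero_mul])
    have hs0 : s ≠ 0 := fun h0 => (mul_ne_zero hε0 hx0) (by rw [← hs, h0, zero_mul])
    have hσt0 : σ t ≠ 0 := (map_ne_zero σ).2 ht0
    refine ⟨s / t, div_ne_zero hs0 ht0, ?_⟩
    have hx' : x = (s * σ s) / (t * σ t) * y := by
      rw [hs, ht]
      field_simp
    rw [hx', map_div₀]
    field_simp

/-! ## §2  The `U(Φ₃)`-classes in the stable class of a frame literal: classification by the norm classes of the eigenvector lengths -/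

/-- **THE `U(Φ₃)(F)`-CLASSES INSIDE THE STABLE CLASS OF A TYPE-(1) LITERAL ARE THE FOUR FRAMES.**  `σ` an involution of the field `K` satisfying the index-two
dichotomy of the local norm index theorem (`ε` a `σ`-fixed non-norm, every `σ`-fixed `s ≠ 0` a norm or `ε`·norm); `f` a four-frame family (H7), `α, β, z` of norm one,
`(α, β, 1)` pairwise distinct; `N_b ∈ U(σ, Φ₃)` with matrix `z·Γ_b` (H8) for each frame `b`.  Then every `M ∈ U(σ, Φ₃)` with `charpoly M = (X − zα)(X − zβ)(X − z)` is
`U(σ, Φ₃)`-conjugate to some `N_b` (`M = S N₀ S⁻¹` in `GL₃`; the eigenvector lengths `rᵢ = ⟨S f_{0,i}, S f_{0,i}⟩` have classes `(ε₁, ε₂, ω(−1)ε₁ε₂)` = those of the frame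
`b = signPair⁻¹(ε₁, ε₂)`, and the criterion in the eigenframe ★ `exists_unitary_conj_iff_forall_exists_norm` conjugates `N_b = (Q_b Q₀⁻¹) N₀ (Q_b Q₀⁻¹)⁻¹` to `M` inside `U(σ, Φ₃)`).
[cite: Rogawski1990, §3.5 Prop. 3.5.2 (a)(c) p. 29; §3.6 p. 31] [cite: Jacobowitz1962, §4] [cite: Serre1979, Ch. XIV §3] -/
theorem exists_unitary_conj_frameElt_of_charpoly_eq {σ : K →+* K} (hσσ : ∀ x, σ (σ x) = x)
    {ε : K} (hσε : σ ε = ε) (hεn : ¬ ∃ t : K, t * σ t = ε)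
    (hdich : ∀ s : K, σ s = s → s ≠ 0 → (∃ t : K, t * σ t = s) ∨ ∃ t : K, t * σ t = ε * s)
    {f : Fin 4 → Fin 3 → (Fin 3 → K)} (hf : IsFourFrameFamily σ f) {α β z : K}
    (hα : α * σ α = 1) (hβ : β * σ β = 1) (hz : z * σ z = 1) (hαβ : α ≠ β) (hα1 : α ≠ 1) (hβ1 : β ≠ 1)
    (N : Fin 4 → GL (Fin 3) K) (hN : ∀ b, (N b : Matrix (Fin 3) (Fin 3) K) = z • frameElt σ f b α β)
    (hNmem : ∀ b, N b ∈ unitaryGroupOfForm σ ((StdForm.antidiagonal 3).over K))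
    {M : GL (Fin 3) K} (hM : M ∈ unitaryGroupOfForm σ ((StdForm.antidiagonal 3).over K))
    (hchar : (M : Matrix (Fin 3) (Fin 3) K).charpoly = ∏ i : Fin 3, (X - C ((![z * α, z * β, z] : Fin 3 → K) i))) :
    ∃ (b : Fin 4) (U : GL (Fin 3) K), U ∈ unitaryGroupOfForm σ ((StdForm.antidiagonal 3).over K) ∧ U * N b * U⁻¹ = M := by
  set Φ : Matrix (Fin 3) (Fin 3) K := (StdForm.antidiagonal 3).over K with hΦ
  set u : Fin 3 → K := ![z * α, z * β, z] with hu_def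
  have hH : (Φ.map σ)ᵀ = Φ := by rw [hΦ, StdForm.over_map, StdForm.transpose_over]
  have hHab : ∀ i j, σ (Φ i j) = Φ j i := fun i j => by simpa only [Matrix.transpose_apply, Matrix.map_apply] using congrFun (congrFun hH j) i
  have hHd : Φ.det ≠ 0 := ((Matrix.isUnit_iff_isUnit_det _).1 ((StdForm.antidiagonal 3).isUnit_over K)).ne_zero
  have hz0 : z ≠ 0 := fun h => by rw [h, zero_mul] at hz; exact zero_ne_one hz
  have hu : Function.Injective u := injective_eigenvalues hαβ hα1 hβ1 hz0
  have hu1 : ∀ i, σ (u i) * u i = 1 := by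
    intro i; fin_cases i
    · show σ (z * α) * (z * α) = 1; rw [map_mul]; linear_combination (σ α * α) * hz + hα
    · show σ (z * β) * (z * β) = 1; rw [map_mul]; linear_combination (σ β * β) * hz + hβ
    · show σ z * z = 1; rw [mul_comm]; exact hz
  have hmemU : ∀ {g : GL (Fin 3) K}, g ∈ unitaryGroupOfForm σ Φ → g ∈ Literature.AlgebraicGeometry.ShimuraVarieties.unitaryGroup σ Φ :=
    fun hg => by rwa [Literature.AlgebraicGeometry.ShimuraVarieties.unitaryGroup_eq_unitaryGroupOfForm]
  -- the frame matrices `Q_b` as eigenframes of the literals `N_b`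
  have hQex : ∀ b, ∃ Q : GL (Fin 3) K, (Q : Matrix (Fin 3) (Fin 3) K) = (Matrix.of (f b))ᵀ ∧
      (N b : Matrix (Fin 3) (Fin 3) K) * (Q : Matrix (Fin 3) (Fin 3) K) = (Q : Matrix (Fin 3) (Fin 3) K) * Matrix.diagonal u := fun b => by
    obtain ⟨Q, hQ, hQe⟩ := exists_eigenframe_smul_frameElt hf b α β z
    exact ⟨Q, hQ, by rw [hN b]; exact hQe⟩
  choose Q hQf hQe using hQex
  -- the norms of the frame vectors
  have hn0 : ∀ b i, pairing σ Φ (f b i) (f b i) ≠ 0 := fun b i => (hf b).2.1 i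
  have hnσ : ∀ b i, σ (pairing σ Φ (f b i) (f b i)) = pairing σ Φ (f b i) (f b i) := fun b i =>
    (pairing_comm_of_hermitian hσσ hHab (f b i) (f b i)).symm
  have htwQ : ∀ b i, twistGram σ Φ (Q b : Matrix (Fin 3) (Fin 3) K) i i = pairing σ Φ (f b i) (f b i) := fun b i => by
    rw [hQf b, twistGram_frameMatrix_apply_self]
  -- `M = S N₀ S⁻¹` in `GL₃(K)`: equal separable characteristic polynomials
  have hcharN : ∀ b, (N b : Matrix (Fin 3) (Fin 3) K).charpoly = ∏ i : Fin 3, (X - C (u i)) := fun b => by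
    rw [hN b]; exact charpoly_smul_frameElt hf b α β z
  have hsep : ((N 0 : Matrix (Fin 3) (Fin 3) K).charpoly).Separable := by
    rw [hN 0]; exact separable_charpoly_smul_frameElt hf 0 hαβ hα1 hβ1 hz0
  obtain ⟨S, hS⟩ := isConj_iff.1 (isConj_of_charpoly_eq_of_separable (N 0) M hsep (by rw [hcharN 0, hchar]))
  have hg' : S * N 0 * S⁻¹ ∈ Literature.AlgebraicGeometry.ShimuraVarieties.unitaryGroup σ Φ := by rw [hS]; exact hmemU hM
  -- the eigenvector lengths `rᵢ` of `M`
  set r : Fin 3 → K := fun i => twistGram σ Φ ((S : Matrix (Fin 3) (Fin 3) K) * (Q 0 : Matrix (Fin 3) (Fin 3) K)) i i with hr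
  have hr0 : ∀ i, r i ≠ 0 := fun i => twistGram_mul_eigenframe_apply_ne_zero σ Φ hHd (hmemU (hNmem 0)) (hQe 0) hu hu1 hg' i
  have hrσ : ∀ i, σ (r i) = r i := fun i => map_twistGram_apply_self σ Φ hσσ hH _ i
  -- the product of the lengths is `N(det S) · ∏ N(f_{0,i})`, hence `ω(r₂) = ω(−1)·ω(r₀)·ω(r₁)`
  have hprod := prod_twistGram_mul_eigenframe_eq σ Φ hHd (hmemU (hNmem 0)) (hQe 0) hu hu1 hg'
  simp only [Fin.prod_univ_three, htwQ] at hprod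
  change r 0 * r 1 * r 2 = _ at hprod
  have hdS : (S : Matrix (Fin 3) (Fin 3) K).det ≠ 0 := (Matrix.isUnits_det_units S).ne_zero
  obtain ⟨-, -, h00, h01, h02⟩ := hf 0
  have hsp0 : signPair 0 = (1, 1) := rfl
  rw [hsp0] at h00 h01 h02
  have hω2 : normSign σ (r 2) = normSign σ (-1) * normSign σ (r 0) * normSign σ (r 1) := by
    have hω := congrArg (normSign σ) hprod
    rw [normSign_mul_of_dichotomy σ hσε hεn hdich (by rw [map_mul, hrσ, hrσ]) (hrσ 2) (mul_ne_zero (hr0 0) (hr0 1)) (hr0 2),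
      normSign_mul_of_dichotomy σ hσε hεn hdich (hrσ 0) (hrσ 1) (hr0 0) (hr0 1), normSign_mul_norm σ hdS,
      normSign_mul_of_dichotomy σ hσε hεn hdich (by rw [map_mul, hnσ, hnσ]) (hnσ 0 2) (mul_ne_zero (hn0 0 0) (hn0 0 1)) (hn0 0 2),
      normSign_mul_of_dichotomy σ hσε hεn hdich (hnσ 0 0) (hnσ 0 1) (hn0 0 0) (hn0 0 1), h00, h01, h02] at hω
    rcases normSign_eq_one_or σ (r 0) with h0 | h0 <;> rcases normSign_eq_one_or σ (r 1) with h1 | h1 <;>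
      rw [h0, h1] at hω ⊢ <;> linarith
  -- the frame `b` with the classes of `M`
  obtain ⟨b, hb⟩ := exists_signPair_eq (normSign_eq_one_or σ (r 0)) (normSign_eq_one_or σ (r 1))
  obtain ⟨-, -, hb0, hb1, hb2⟩ := hf b
  rw [hb] at hb0 hb1 hb2
  -- `S_b := Q_b Q₀⁻¹` conjugates `N₀` to `N_b` and carries the frame `Q₀` to `Q_b`
  set Sb : GL (Fin 3) K := Q b * (Q 0)⁻¹ with hSb
  have hSbQ : (Sb : Matrix (Fin 3) (Fin 3) K) * (Q 0 : Matrix (Fin 3) (Fin 3) K) = (Q b : Matrix (Fin 3) (Fin 3) K) := by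
    rw [hSb, ← Units.val_mul, inv_mul_cancel_right]
  have hD' : ∀ b', (((Q b')⁻¹ * N b' * Q b' : GL (Fin 3) K) : Matrix (Fin 3) (Fin 3) K) = Matrix.diagonal u := fun b' => by
    rw [Units.val_mul, Units.val_mul, Matrix.mul_assoc, hQe b', ← Matrix.mul_assoc, Units.inv_mul, Matrix.one_mul]
  have hD : (Q b)⁻¹ * N b * Q b = (Q 0)⁻¹ * N 0 * Q 0 := Units.ext (by rw [hD', hD'])
  have hSbN : Sb * N 0 * Sb⁻¹ = N b := by
    calc Sb * N 0 * Sb⁻¹ = Q b * ((Q 0)⁻¹ * N 0 * Q 0) * (Q b)⁻¹ := by rw [hSb]; group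
      _ = Q b * ((Q b)⁻¹ * N b * Q b) * (Q b)⁻¹ := by rw [hD]
      _ = N b := by group
  have hg : Sb * N 0 * Sb⁻¹ ∈ Literature.AlgebraicGeometry.ShimuraVarieties.unitaryGroup σ Φ := by rw [hSbN]; exact hmemU (hNmem b)
  -- the criterion in the eigenframe: all three length ratios are norms
  have hnorms : ∀ i, ∃ c : K, IsUnit c ∧ twistGram σ Φ ((S : Matrix (Fin 3) (Fin 3) K) * (Q 0 : Matrix (Fin 3) (Fin 3) K)) i i =
      σ c * c * twistGram σ Φ ((Sb : Matrix (Fin 3) (Fin 3) K) * (Q 0 : Matrix (Fin 3) (Fin 3) K)) i i := by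
    intro i
    rw [hSbQ, htwQ]
    change ∃ c : K, IsUnit c ∧ r i = σ c * c * pairing σ Φ (f b i) (f b i)
    have hωi : normSign σ (r i) = normSign σ (pairing σ Φ (f b i) (f b i)) := by
      fin_cases i
      · exact hb0.symm
      · exact hb1.symm
      · show normSign σ (r 2) = normSign σ (pairing σ Φ (f b 2) (f b 2)); rw [hb2, hω2]
    obtain ⟨c, hc0, hc⟩ := exists_eq_norm_mul_of_normSign_eq σ hεn hdich (hrσ i) (hnσ b i) (hr0 i) (hn0 b i) hωi
    exact ⟨c, Ne.isUnit hc0, hc⟩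
  obtain ⟨W, hW, hWc⟩ := (exists_unitary_conj_iff_forall_exists_norm σ Φ hHd (hmemU (hNmem 0)) (hQe 0) hu hu1 hg hg').2 hnorms
  rw [hSbN, hS] at hWc
  rw [Literature.AlgebraicGeometry.ShimuraVarieties.unitaryGroup_eq_unitaryGroupOfForm] at hW
  exact ⟨b, W, hW, hWc⟩

end Generic
/-! ## §3  One-place plumbing at a non-split CM place: conjugacy in `U(Φ₃)(L⁺_v)` versus unitary conjugacy of the one-place matrices -/

section CM

variable (L : Type) [Field L] [NumberField L] [IsCMField L] {v : HeightOneSpectrum (𝓞 ↥(maximalRealSubfield L))}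
  (w : UnitaryGroup.PlacesOver L v) (hw : IsCMField.complexConj L • w.1 = w.1)

/-- **MATCHING IS CONJUGACY OF THE ONE-PLACE MATRICES** (★ `isLocalNormPair_iff_isConj_endoGL_conj` at `T = 1`): `ι_v(γ_H) ↔ t` iff
`ι((γ_H.1)_w, (γ_H.2)_w)` and `t_w` are conjugate in `GL₃(L_w)`. [cite: Rogawski1990, §3.1 p. 19; §4.9 p. 54] [cite: PlatonovRapinchuk1994, §5.1] -/
theorem isLocalNormPair_iff_isConj_endoGL_one (γH : ((UnitaryGroup.cmDatum L 2 (Matrix.of fun i j : Fin 2 => if i.val + j.val + 1 = 2 then (1 : L) else 0)).Local v × (UnitaryGroup.cmDatum L 1 (Matrix.of fun i j : Fin 1 => if i.val + j.val + 1 = 1 then (1 : L) else 0)).Local v)) (t : ((UnitaryGroup.cmDatum L 3 (Matrix.of fun i j : Fin 3 => if i.val + j.val + 1 = 3 then (1 : L) else 0)).Local v)) :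
    IsLocalNormPair L (Matrix.of fun i j : Fin 3 => if i.val + j.val + 1 = 3 then (1 : L) else 0) v γH t ↔
      IsConj (endoGL (((localNonsplitEquiv (IsCMField.complexConj L) (Matrix.of fun i j : Fin 2 => if i.val + j.val + 1 = 2 then (1 : L) else 0) (IsCMField.complexConj_ne_one L) w hw γH.1 : ↥(unitaryGroupOfForm (galAdicCompletionMap (L := L) (IsCMField.complexConj L) hw) (placeForm (Matrix.of fun i j : Fin 2 => if i.val + j.val + 1 = 2 then (1 : L) else 0) w.1))) : GL (Fin 2) (w.1.adicCompletion L)), ((localNonsplitEquiv (IsCMField.complexConj L) (Matrix.of fun i j : Fin 1 => if i.val + j.val + 1 = 1 then (1 : L) else 0) (IsCMField.complexConj_ne_one L) w hw γH.2 : ↥(unitaryGroupOfForm (galAdicCompletionMap (L := L) (IsCMField.complexConj L) hw) (placeForm (Matrix.of fun i j : Fin 1 => if i.val + j.val + 1 = 1 then (1 : L) else 0) w.1))) : GL (Fin 1) (w.1.adicCompletion L))))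
        ((localNonsplitEquiv (IsCMField.complexConj L) (Matrix.of fun i j : Fin 3 => if i.val + j.val + 1 = 3 then (1 : L) else 0) (IsCMField.complexConj_ne_one L) w hw t : ↥(unitaryGroupOfForm (galAdicCompletionMap (L := L) (IsCMField.complexConj L) hw) (placeForm (Matrix.of fun i j : Fin 3 => if i.val + j.val + 1 = 3 then (1 : L) else 0) w.1))) : GL (Fin 3) (w.1.adicCompletion L)) := by
  rw [isLocalNormPair_iff_isConj_endoGL_conj L (Matrix.of fun i j : Fin 3 => if i.val + j.val + 1 = 3 then (1 : L) else 0) w hw 1 γH t]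
  simp only [one_mul, inv_one, mul_one]

/-- **`charpoly ι((γ_H)_w) = (X − za²)(X − zb²)(X − z)` FROM THE PINS**: `χ_{g_w}` is the monic quadratic with the two distinct roots `za², zb²` and the `U(Φ₁)`-entry at
`w` is `γ₂ = z` (★ `finGammaTwo`). [cite: Rogawski1990, §4.9 p. 55] -/
theorem charpoly_endoGL_eq_of_pins (γH : ((UnitaryGroup.cmDatum L 2 (Matrix.of fun i j : Fin 2 => if i.val + j.val + 1 = 2 then (1 : L) else 0)).Local v × (UnitaryGroup.cmDatum L 1 (Matrix.of fun i j : Fin 1 => if i.val + j.val + 1 = 1 then (1 : L) else 0)).Local v)) {a b z : (w.1.adicCompletion L)} (hz0 : z ≠ 0) (hab : a * a ≠ b * b) (hzpin : z = finGammaTwo L v γH w)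
    (hra : ((((γH).1.val : GL (Fin 2) (UnitaryGroup.LocalRing L v)).val.map (Pi.evalRingHom (fun w' : UnitaryGroup.PlacesOver L v => w'.1.adicCompletion L) w))).charpoly.IsRoot (z * (a * a)))
    (hrb : ((((γH).1.val : GL (Fin 2) (UnitaryGroup.LocalRing L v)).val.map (Pi.evalRingHom (fun w' : UnitaryGroup.PlacesOver L v => w'.1.adicCompletion L) w))).charpoly.IsRoot (z * (b * b))) :
    ((endoGL (((localNonsplitEquiv (IsCMField.complexConj L) (Matrix.of fun i j : Fin 2 => if i.val + j.val + 1 = 2 then (1 : L) else 0) (IsCMField.complexConj_ne_one L) w hw γH.1 : ↥(unitaryGroupOfForm (galAdicCompletionMap (L := L) (IsCMField.complexConj L) hw) (placeForm (Matrix.of fun i j : Fin 2 => if i.val + j.val + 1 = 2 then (1 : L) else 0) w.1))) : GL (Fin 2) (w.1.adicCompletion L)), ((localNonsplitEquiv (IsCMField.complexConj L) (Matrix.of fun i j : Fin 1 => if i.val + j.val + 1 = 1 then (1 : L) else 0) (IsCMField.complexConj_ne_one L) w hw γH.2 : ↥(unitaryGroupOfForm (galAdicCompletionMap (L := L) (IsCMField.complexConj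 L) hw) (placeForm (Matrix.of fun i j : Fin 1 => if i.val + j.val + 1 = 1 then (1 : L) else 0) w.1))) : GL (Fin 1) (w.1.adicCompletion L))) : GL (Fin 3) (w.1.adicCompletion L)) :
        Matrix (Fin 3) (Fin 3) (w.1.adicCompletion L)).charpoly = ∏ i : Fin 3, (X - C ((![z * (a * a), z * (b * b), z] : Fin 3 → (w.1.adicCompletion L)) i)) := by
  set g₂ : GL (Fin 2) (w.1.adicCompletion L) := ((localNonsplitEquiv (IsCMField.complexConj L) (Matrix.of fun i j : Fin 2 => if i.val + j.val + 1 = 2 then (1 : L) else 0) (IsCMField.complexConj_ne_one L) w hw γH.1 : ↥(unitaryGroupOfForm (galAdicCompletionMap (L := L) (IsCMField.complexConj L) hw) (placeForm (Matrix.of fun i j : Fin 2 => if i.val + j.val + 1 = 2 then (1 : L) else 0) w.1))) : GL (Fin 2) (w.1.adicCompletion L)) with hg₂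
  set g₁ : GL (Fin 1) (w.1.adicCompletion L) := ((localNonsplitEquiv (IsCMField.complexConj L) (Matrix.of fun i j : Fin 1 => if i.val + j.val + 1 = 1 then (1 : L) else 0) (IsCMField.complexConj_ne_one L) w hw γH.2 : ↥(unitaryGroupOfForm (galAdicCompletionMap (L := L) (IsCMField.complexConj L) hw) (placeForm (Matrix.of fun i j : Fin 1 => if i.val + j.val + 1 = 1 then (1 : L) else 0) w.1))) : GL (Fin 1) (w.1.adicCompletion L)) with hg₁
  have hg₂val : (g₂ : Matrix (Fin 2) (Fin 2) (w.1.adicCompletion L)) =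
      ((γH).1.val : GL (Fin 2) (UnitaryGroup.LocalRing L v)).val.map (Pi.evalRingHom (fun w' : UnitaryGroup.PlacesOver L v => w'.1.adicCompletion L) w) := rfl
  have hg₁val : (g₁ : Matrix (Fin 1) (Fin 1) (w.1.adicCompletion L)) 0 0 = z := by rw [hzpin]; rfl
  have hchar2 : (g₂ : Matrix (Fin 2) (Fin 2) (w.1.adicCompletion L)).charpoly = (X - C (z * (a * a))) * (X - C (z * (b * b))) := by
    rw [hg₂val]
    refine eq_X_sub_C_mul_X_sub_C_of_isRoot_of_isRoot (Matrix.charpoly_monic _) ?_ hra hrb fun h => hab (mul_left_cancel₀ hz0 h)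
    rw [Matrix.charpoly_natDegree_eq_dim, Fintype.card_fin]
  rw [charpoly_endoGL, hchar2, hg₁val, Fin.prod_univ_three]
  rfl

/-- **CONJUGATES IN `U(Φ₃)(L⁺_v)` HAVE CONJUGATE ONE-PLACE MATRICES**: `⟦t⟧ = ⟦s⟧` ⇒ `t_w ∼ s_w` in `GL₃(L_w)` (the one-place model ★ `localNonsplitEquiv` is a group
isomorphism into `U(σ_w, Φ₃)(L_w) ≤ GL₃(L_w)`). [cite: PlatonovRapinchuk1994, §5.1] [cite: Rogawski1990, §3.1 p. 19] -/
theorem isConj_coe_localNonsplitEquiv_of_mk_eq_mk {s t : ((UnitaryGroup.cmDatum L 3 (Matrix.of fun i j : Fin 3 => if i.val + j.val + 1 = 3 then (1 : L) else 0)).Local v)} (h : ConjClasses.mk t = ConjClasses.mk s) :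
    IsConj ((localNonsplitEquiv (IsCMField.complexConj L) (Matrix.of fun i j : Fin 3 => if i.val + j.val + 1 = 3 then (1 : L) else 0) (IsCMField.complexConj_ne_one L) w hw t : ↥(unitaryGroupOfForm (galAdicCompletionMap (L := L) (IsCMField.complexConj L) hw) (placeForm (Matrix.of fun i j : Fin 3 => if i.val + j.val + 1 = 3 then (1 : L) else 0) w.1))) : GL (Fin 3) (w.1.adicCompletion L)) ((localNonsplitEquiv (IsCMField.complexConj L) (Matrix.of fun i j : Fin 3 => if i.val + j.val + 1 = 3 then (1 : L) else 0) (IsCMField.complexConj_ne_one L) w hw s : ↥(unitaryGroupOfForm (galAdicCompletionMap (L := L) (IsCMField.complexConj L) hw) (placeForm (Matrix.of fun i j : Fin 3 => if i.val + j.val + 1 = 3 then (1 : L) else 0) w.1))) : GL (Fin 3) (w.1.adicCompletion L)) := by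
  set e := localNonsplitEquiv (IsCMField.complexConj L) (Matrix.of fun i j : Fin 3 => if i.val + j.val + 1 = 3 then (1 : L) else 0) (IsCMField.complexConj_ne_one L) w hw with he_def
  obtain ⟨y, hy⟩ := isConj_iff.1 (ConjClasses.mk_eq_mk_iff_isConj.1 h)
  -- `e` is multiplicative (term-mode `map_mul`: the carrier `(cmDatum …).Local v` is the subgroup `↥(local …)` by `def`)
  have hemul : ∀ x x' : ((UnitaryGroup.cmDatum L 3 (Matrix.of fun i j : Fin 3 => if i.val + j.val + 1 = 3 then (1 : L) else 0)).Local v), e (x * x') = e x * e x' := fun x x' => map_mul e x x'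
  have heinv : ∀ x : ((UnitaryGroup.cmDatum L 3 (Matrix.of fun i j : Fin 3 => if i.val + j.val + 1 = 3 then (1 : L) else 0)).Local v), e (x⁻¹ : ((UnitaryGroup.cmDatum L 3 (Matrix.of fun i j : Fin 3 => if i.val + j.val + 1 = 3 then (1 : L) else 0)).Local v)) = (e x)⁻¹ := fun x => map_inv e x
  have h1 : ((e (y * t * y⁻¹) : ↥(unitaryGroupOfForm (galAdicCompletionMap (L := L) (IsCMField.complexConj L) hw) (placeForm (Matrix.of fun i j : Fin 3 => if i.val + j.val + 1 = 3 then (1 : L) else 0) w.1))) : GL (Fin 3) (w.1.adicCompletion L)) =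
      ((e y : ↥(unitaryGroupOfForm (galAdicCompletionMap (L := L) (IsCMField.complexConj L) hw) (placeForm (Matrix.of fun i j : Fin 3 => if i.val + j.val + 1 = 3 then (1 : L) else 0) w.1))) : GL (Fin 3) (w.1.adicCompletion L)) * ((e t : ↥(unitaryGroupOfForm (galAdicCompletionMap (L := L) (IsCMField.complexConj L) hw) (placeForm (Matrix.of fun i j : Fin 3 => if i.val + j.val + 1 = 3 then (1 : L) else 0) w.1))) : GL (Fin 3) (w.1.adicCompletion L)) * ((e y : ↥(unitaryGroupOfForm (galAdicCompletionMap (L := L) (IsCMField.complexConj L) hw) (placeForm (Matrix.of fun i j : Fin 3 => if i.val + j.val + 1 = 3 then (1 : L) else 0) w.1))) : GL (Fin 3) (w.1.adicCompletion L))⁻¹ := by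
    simp only [hemul, heinv, Subgroup.coe_mul, Subgroup.coe_inv]
  exact isConj_iff.2 ⟨((e y : ↥(unitaryGroupOfForm (galAdicCompletionMap (L := L) (IsCMField.complexConj L) hw) (placeForm (Matrix.of fun i j : Fin 3 => if i.val + j.val + 1 = 3 then (1 : L) else 0) w.1))) : GL (Fin 3) (w.1.adicCompletion L)), h1.symm.trans (congrArg (fun x : ((UnitaryGroup.cmDatum L 3 (Matrix.of fun i j : Fin 3 => if i.val + j.val + 1 = 3 then (1 : L) else 0)).Local v) => ((e x : ↥(unitaryGroupOfForm (galAdicCompletionMap (L := L) (IsCMField.complexConj L) hw) (placeForm (Matrix.of fun i j : Fin 3 => if i.val + j.val + 1 = 3 then (1 : L) else 0) w.1))) : GL (Fin 3) (w.1.adicCompletion L))) hy)⟩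

/-- **A UNITARY CONJUGATOR OF THE ONE-PLACE MATRICES PULLS BACK TO `U(Φ₃)(L⁺_v)`**: if `U ∈ U(σ_w, Φ₃)(L_w)` has `U s_w U⁻¹ = t_w` then `⟦t⟧ = ⟦s⟧` (pull `U` back
along ★ `localNonsplitEquiv`, ★ `placeForm_antidiagOne`). [cite: PlatonovRapinchuk1994, §5.1] [cite: Rogawski1990, §3.1 p. 19] -/
theorem mk_eq_mk_of_unitary_conj_eq {U : GL (Fin 3) (w.1.adicCompletion L)}
    (hU : U ∈ unitaryGroupOfForm (galAdicCompletionMap (L := L) (IsCMField.complexConj L) hw) ((StdForm.antidiagonal 3).over (w.1.adicCompletion L)))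
    {s t : ((UnitaryGroup.cmDatum L 3 (Matrix.of fun i j : Fin 3 => if i.val + j.val + 1 = 3 then (1 : L) else 0)).Local v)} (h : U * ((localNonsplitEquiv (IsCMField.complexConj L) (Matrix.of fun i j : Fin 3 => if i.val + j.val + 1 = 3 then (1 : L) else 0) (IsCMField.complexConj_ne_one L) w hw s : ↥(unitaryGroupOfForm (galAdicCompletionMap (L := L) (IsCMField.complexConj L) hw) (placeForm (Matrix.of fun i j : Fin 3 => if i.val + j.val + 1 = 3 then (1 : L) else 0) w.1))) : GL (Fin 3) (w.1.adicCompletion L)) * U⁻¹ = ((localNonsplitEquiv (IsCMField.complexConj L) (Matrix.of fun i j : Fin 3 => if i.val + j.val + 1 = 3 then (1 : L) else 0) (IsCMField.complexConj_ne_one L) w hw t : ↥(unitaryGroupOfForm (galAdicCompletionMap (L := L) (IsCMField.complexConj L) hw) (placeForm (Matrix.of fun i j : Fin 3 => if i.val + j.val + 1 = 3 then (1 : L) else 0) w.1))) : GL (Fin 3) (w.1.adicCompletion L))) :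
    ConjClasses.mk t = ConjClasses.mk s := by
  set e := localNonsplitEquiv (IsCMField.complexConj L) (Matrix.of fun i j : Fin 3 => if i.val + j.val + 1 = 3 then (1 : L) else 0) (IsCMField.complexConj_ne_one L) w hw with he_def
  have hU' : U ∈ unitaryGroupOfForm (galAdicCompletionMap (L := L) (IsCMField.complexConj L) hw) (placeForm (Matrix.of fun i j : Fin 3 => if i.val + j.val + 1 = 3 then (1 : L) else 0) w.1) := by
    rw [placeForm_antidiagOne]; exact hU
  obtain ⟨y, hey⟩ : ∃ y : ((UnitaryGroup.cmDatum L 3 (Matrix.of fun i j : Fin 3 => if i.val + j.val + 1 = 3 then (1 : L) else 0)).Local v), ((e y : ↥(unitaryGroupOfForm (galAdicCompletionMap (L := L) (IsCMField.complexConj L) hw) (placeForm (Matrix.of fun i j : Fin 3 => if i.val + j.val + 1 = 3 then (1 : L) else 0) w.1))) : GL (Fin 3) (w.1.adicCompletion L)) = U :=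
    ⟨e.symm ⟨U, hU'⟩, congrArg Subtype.val (ContinuousMulEquiv.apply_symm_apply e ⟨U, hU'⟩)⟩
  have hemul : ∀ x x' : ((UnitaryGroup.cmDatum L 3 (Matrix.of fun i j : Fin 3 => if i.val + j.val + 1 = 3 then (1 : L) else 0)).Local v), e (x * x') = e x * e x' := fun x x' => map_mul e x x'
  have heinv : ∀ x : ((UnitaryGroup.cmDatum L 3 (Matrix.of fun i j : Fin 3 => if i.val + j.val + 1 = 3 then (1 : L) else 0)).Local v), e (x⁻¹ : ((UnitaryGroup.cmDatum L 3 (Matrix.of fun i j : Fin 3 => if i.val + j.val + 1 = 3 then (1 : L) else 0)).Local v)) = (e x)⁻¹ := fun x => map_inv e x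
  have h1 : ((e (y * s * y⁻¹) : ↥(unitaryGroupOfForm (galAdicCompletionMap (L := L) (IsCMField.complexConj L) hw) (placeForm (Matrix.of fun i j : Fin 3 => if i.val + j.val + 1 = 3 then (1 : L) else 0) w.1))) : GL (Fin 3) (w.1.adicCompletion L)) =
      ((e y : ↥(unitaryGroupOfForm (galAdicCompletionMap (L := L) (IsCMField.complexConj L) hw) (placeForm (Matrix.of fun i j : Fin 3 => if i.val + j.val + 1 = 3 then (1 : L) else 0) w.1))) : GL (Fin 3) (w.1.adicCompletion L)) * ((e s : ↥(unitaryGroupOfForm (galAdicCompletionMap (L := L) (IsCMField.complexConj L) hw) (placeForm (Matrix.of fun i j : Fin 3 => if i.val + j.val + 1 = 3 then (1 : L) else 0) w.1))) : GL (Fin 3) (w.1.adicCompletion L)) * ((e y : ↥(unitaryGroupOfForm (galAdicCompletionMap (L := L) (IsCMField.complexConj L) hw) (placeForm (Matrix.of fun i j : Fin 3 => if i.val + j.val + 1 = 3 then (1 : L) else 0) w.1))) : GL (Fin 3) (w.1.adicCompletion L))⁻¹ := by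
    simp only [hemul, heinv, Subgroup.coe_mul, Subgroup.coe_inv]
  rw [hey] at h1
  refine (ConjClasses.mk_eq_mk_iff_isConj.2 (isConj_iff.2 ⟨y, ?_⟩)).symm
  apply e.injective
  apply Subtype.ext
  exact h1.trans h

end CM
/-! ## §4  The head: `U1_Frames.stub_U1_normPairs_iff_frames` TOKEN FOR TOKEN -/

/-- **PAYMENT OF `stub_U1_normPairs_iff_frames`** (tier-1 socket `U1_Frames`, unit (i); (D-CΔ) clause (C)₁): for `γ_H ∈ H(L⁺_v)` and ANY four-frame family `f`,
norm-one `a, b, z` pinned to `γ_H` (`z = finGammaTwo`, `z a², z b²` the roots of `χ_g` at `w`), regular element datum and group literals `t_b` with one-place matrix `z·Γ_b`: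
`IsLocalNormPair L Φ₃ v γ_H t ↔ ∃ b, ⟦t⟧ = ⟦t_b⟧`.  Matching is conjugacy of the one-place matrices (§3) and `charpoly ι((γ_H)_w) = (X − za²)(X − zb²)(X − z) = charpoly (z·Γ_b)`
(pins; separable), so (←) is ★ `isConj_of_charpoly_eq_of_separable` and (→) is the `U(Φ₃)`-classification §2 pulled back along ★ `localNonsplitEquiv` (§3); `V = univ` (no
smallness, `G`-regularity or ellipticity is used). [cite: Rogawski1990, §3.5 Prop. 3.5.2 (a)(c) p. 29; §3.6 pp. 28–31; §4.9 Prop. 4.9.1 (a) p. 55] [cite: Jacobowitz1962, §4] -/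
theorem normPairs_iff_frames (N₀ : ℕ → ℕ) :
    ∀ (L : Type) [Field L] [NumberField L] [IsCMField L]
      {v : HeightOneSpectrum (𝓞 ↥(maximalRealSubfield L))} (w : UnitaryGroup.PlacesOver L v)
      (hw : IsCMField.complexConj L • w.1 = w.1) (_he : v.asIdeal.ramificationIdx' w.1.asIdeal ≠ 1)
      (_h2 : ¬ IsUnit (2 : (ValuativeRel.valuation (w.1.adicCompletion L)).integer))
      (ϖ : (w.1.adicCompletion L)) (_hϖ : Valued.v ϖ = WithZero.exp (-1 : ℤ)) (d tE : ℕ) (_hD : IsRamifiedQuadraticDatum (galAdicCompletionMap (L := L) (IsCMField.complexConj L) hw) ϖ d tE),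
      ∃ V ∈ 𝓝 (1 : ((UnitaryGroup.cmDatum L 2 (Matrix.of fun i j : Fin 2 => if i.val + j.val + 1 = 2 then (1 : L) else 0)).Local v × (UnitaryGroup.cmDatum L 1 (Matrix.of fun i j : Fin 1 => if i.val + j.val + 1 = 1 then (1 : L) else 0)).Local v)), ∀ γH ∈ V, IsLocalGRegular L v γH →
        (∃ x : (w.1.adicCompletion L), (((((γH).1.val : GL (Fin 2) (UnitaryGroup.LocalRing L v)).val.map (Pi.evalRingHom (fun w' : UnitaryGroup.PlacesOver L v => w'.1.adicCompletion L) w))).charpoly).IsRoot x) →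
        ¬ (∃ (y : ((UnitaryGroup.cmDatum L 2 (Matrix.of fun i j : Fin 2 => if i.val + j.val + 1 = 2 then (1 : L) else 0)).Local v × (UnitaryGroup.cmDatum L 1 (Matrix.of fun i j : Fin 1 => if i.val + j.val + 1 = 1 then (1 : L) else 0)).Local v)) (d' : Fin 2 → (UnitaryGroup.LocalRing L v)ˣ),
            glDiagonal 2 (UnitaryGroup.LocalRing L v) d' = ((y * γH * y⁻¹).1.val : GL (Fin 2) (UnitaryGroup.LocalRing L v))) →
        ∀ (f : Fin 4 → Fin 3 → (Fin 3 → (w.1.adicCompletion L))) (_ : IsFourFrameFamily (galAdicCompletionMap (L := L) (IsCMField.complexConj L) hw) f)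
          (a b z : (w.1.adicCompletion L)) (_ : a * (galAdicCompletionMap (L := L) (IsCMField.complexConj L) hw) a = 1) (_ : b * (galAdicCompletionMap (L := L) (IsCMField.complexConj L) hw) b = 1) (_ : z * (galAdicCompletionMap (L := L) (IsCMField.complexConj L) hw) z = 1)
          (_ : z = finGammaTwo L v γH w) (_ : ((((γH).1.val : GL (Fin 2) (UnitaryGroup.LocalRing L v)).val.map (Pi.evalRingHom (fun w' : UnitaryGroup.PlacesOver L v => w'.1.adicCompletion L) w))).charpoly.IsRoot (z * (a * a))) (_ : ((((γH).1.val : GL (Fin 2) (UnitaryGroup.LocalRing L v)).val.map (Pi.evalRingHom (fun w' : UnitaryGroup.PlacesOver L v => w'.1.adicCompletion L) w))).charpoly.IsRoot (z * (b * b)))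
          (n₁ n₂ n₃ : ℕ) (_ : IsElementDatum (galAdicCompletionMap (L := L) (IsCMField.complexConj L) hw) ϖ (N₀ d) (a * a) (b * b) n₁ n₂ n₃)
          (Γ : Fin 4 → GL (Fin 3) (w.1.adicCompletion L)) (_ : ∀ b', (Γ b' : Matrix (Fin 3) (Fin 3) (w.1.adicCompletion L)) = frameElt (galAdicCompletionMap (L := L) (IsCMField.complexConj L) hw) f b' (a * a) (b * b))
          (tb : Fin 4 → ((UnitaryGroup.cmDatum L 3 (Matrix.of fun i j : Fin 3 => if i.val + j.val + 1 = 3 then (1 : L) else 0)).Local v)) (_ : ∀ b', ((((localNonsplitEquiv (IsCMField.complexConj L) (Matrix.of fun i j : Fin 3 => if i.val + j.val + 1 = 3 then (1 : L) else 0) (IsCMField.complexConj_ne_one L) w hw (tb b') :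
              ↥(unitaryGroupOfForm (galAdicCompletionMap (L := L) (IsCMField.complexConj L) hw) (placeForm (Matrix.of fun i j : Fin 3 => if i.val + j.val + 1 = 3 then (1 : L) else 0) w.1))) : GL (Fin 3) (w.1.adicCompletion L)) : Matrix (Fin 3) (Fin 3) (w.1.adicCompletion L))) = z • (Γ b' : Matrix (Fin 3) (Fin 3) (w.1.adicCompletion L))),
          (∀ t : ((UnitaryGroup.cmDatum L 3 (Matrix.of fun i j : Fin 3 => if i.val + j.val + 1 = 3 then (1 : L) else 0)).Local v), IsLocalNormPair L (Matrix.of fun i j : Fin 3 => if i.val + j.val + 1 = 3 then (1 : L) else 0) v γH t ↔ ∃ b', ConjClasses.mk t = ConjClasses.mk (tb b')) := by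
  intro L _ _ _ v w hw _he _h2 ϖ _hϖ d tE hD
  refine ⟨Set.univ, Filter.univ_mem, ?_⟩
  intro γH _ _hreg _hsplit _hell f hf a b z ha hb hz hzpin hra hrb n₁ n₂ n₃ hE Γ hΓ tb htb t
  set σw := galAdicCompletionMap (L := L) (IsCMField.complexConj L) hw with hσw
  set e := localNonsplitEquiv (IsCMField.complexConj L) (Matrix.of fun i j : Fin 3 => if i.val + j.val + 1 = 3 then (1 : L) else 0) (IsCMField.complexConj_ne_one L) w hw with he_def
  obtain ⟨hα, hβ, hαβ, hα1, hβ1, -⟩ := hE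
  have hσσ : ∀ x, σw (σw x) = x := hD.1
  have hz0 : z ≠ 0 := fun h => by rw [h, zero_mul] at hz; exact zero_ne_one hz
  -- the local norm index in `σ_w`-currency: a fixed non-norm `ε` and the dichotomy (★ (J3))
  obtain ⟨ε, hσε, -, hεn, hdich⟩ : ∃ ε : w.1.adicCompletion L, σw ε = ε ∧ ε ≠ 0 ∧ (∀ s, s * σw s ≠ ε) ∧
      ∀ s, σw s = s → s ≠ 0 → (∃ t', t' * σw t' = s) ∨ ∃ t', t' * σw t' = ε * s :=
    Literature.NumberTheory.LocalFields.IsCMField.exists_fixed_nonnorm_dichotomy L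
      (⟨w.1, w.2⟩ : Literature.NumberTheory.GaloisRepresentations.SemiLocal.Place ↥(maximalRealSubfield L) L v) hw
  have hεn' : ¬ ∃ t', t' * σw t' = ε := fun ⟨t', ht'⟩ => hεn t' ht'
  -- the four literals in `GL₃(L_w)` (matrix `z·Γ_b`, unitary for `Φ₃`, characteristic polynomial `(X − za²)(X − zb²)(X − z)`) and the endoscopic side `ι((γ_H)_w)`
  set Nb : Fin 4 → GL (Fin 3) (w.1.adicCompletion L) := fun b' => ((e (tb b') : ↥(unitaryGroupOfForm (galAdicCompletionMap (L := L) (IsCMField.complexConj L) hw) (placeForm (Matrix.of fun i j : Fin 3 => if i.val + j.val + 1 = 3 then (1 : L) else 0) w.1))) : GL (Fin 3) (w.1.adicCompletion L)) with hNb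
  have hNval : ∀ b', (Nb b' : Matrix (Fin 3) (Fin 3) (w.1.adicCompletion L)) = z • frameElt σw f b' (a * a) (b * b) := fun b' =>
    (htb b').trans (by rw [hΓ b'])
  have hNmem : ∀ b', Nb b' ∈ unitaryGroupOfForm σw ((StdForm.antidiagonal 3).over (w.1.adicCompletion L)) := fun b' => by
    rw [← placeForm_antidiagOne]; exact (e (tb b')).2
  have hcharN : ∀ b', (Nb b' : Matrix (Fin 3) (Fin 3) (w.1.adicCompletion L)).charpoly =
      ∏ i : Fin 3, (X - C ((![z * (a * a), z * (b * b), z] : Fin 3 → w.1.adicCompletion L) i)) := fun b' => by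
    rw [hNval b']; exact charpoly_smul_frameElt hf b' (a * a) (b * b) z
  have hcharA := charpoly_endoGL_eq_of_pins L w hw γH hz0 hαβ hzpin hra hrb
  have hsepA := hcharA ▸ Polynomial.separable_prod_X_sub_C_iff.2 (injective_eigenvalues hαβ hα1 hβ1 hz0)
  rw [isLocalNormPair_iff_isConj_endoGL_one L w hw γH t]
  constructor
  · -- (→): `t_w` is unitary with the separable type-(1) characteristic polynomial ⇒ `U(Φ₃)`-conjugate to a literal (§2), pulled back (§3)
    intro hconj
    have hM : ((e t : ↥(unitaryGroupOfForm (galAdicCompletionMap (L := L) (IsCMField.complexConj L) hw) (placeForm (Matrix.of fun i j : Fin 3 => if i.val + j.val + 1 = 3 then (1 : L) else 0) w.1))) : GL (Fin 3) (w.1.adicCompletion L)) ∈ unitaryGroupOfForm σw ((StdForm.antidiagonal 3).over (w.1.adicCompletion L)) := by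
      rw [← placeForm_antidiagOne]; exact (e t).2
    obtain ⟨b', U, hU, hUc⟩ := exists_unitary_conj_frameElt_of_charpoly_eq hσσ hσε hεn' hdich hf hα hβ hz hαβ hα1 hβ1 Nb hNval hNmem hM
      ((charpoly_eq_of_isConj hconj).trans hcharA)
    exact ⟨b', mk_eq_mk_of_unitary_conj_eq L w hw hU hUc⟩
  · -- (←): conjugates of `t_b` have conjugate one-place matrices (§3), whose characteristic polynomial is that of `ι((γ_H)_w)`, separable
    rintro ⟨b', hb'⟩
    have hconjGL := isConj_coe_localNonsplitEquiv_of_mk_eq_mk L w hw hb'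
    exact isConj_of_charpoly_eq_of_separable _ _ hsepA (hcharA.trans ((hcharN b').symm.trans (charpoly_eq_of_isConj hconjGL)))

end Summit.HodgeConjecture.HodgeConjecture.Cruxes.H413.F0P3cDyRamNormPairsIffFrames

end
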